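import Literature.Computation.Certificates.PsdRoundedTwinScaled
import Literature.Computation.Certificates.PackedGramRowsOfLists
import Mathlib.Data.Rat.Floor
import Mathlib.Tactic.LinearCombination

/-!
# The IMPLICIT rounded twin: the twin matrix recomputed in the kernel, only the factor shipped

Compute-infrastructure file (certnum L4, 2026-08-27; third stage of the rounded-twin PSD lane after
`PsdRoundedTwinPacked.lean` (twin shipped as packed rows) and `PsdRoundedTwinScaled.lean`
(equilibration)). In the shipped lane the twin `M = 4^b·(round(S·Q′) − s·1)` (`Q′ = D Q D`) travels
as packed row numerals (`≈ s²·w/8` bytes: 550 KB at `s = 189` unscaled, 260 KB equilibrated) and the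
kernel checks entrywise CLOSENESS of `S·Q′` to `M + s·1`. Both are redundant: `M` is a FUNCTION of
the client's rows, and its closeness (`|S·q′ − round(S·q′)| ≤ ½`) is a LEMMA, not a computation. This
file defines the twin rows IN THE KERNEL — `PSD.twinRows S s b cs n 0 cs Qrows : List (List ℤ)`,
entry `(i, j) ↦ 4^b·(⌊S·2^{c_i+c_j}·q_ij + ½⌋ − s·[i = j])` (structural recursion, fuel `n`, ONE
integer division per entry — `PSD.roundHUZ`, no `ℚ` normalisation) — proves their closeness to `4^b·S·(D Q D)` once and for all
(`PSD.twinRows_close`, tolerance `e = 4^b`), and concludes `∀ y, 0 ≤ yᵀ Q y` from the packed-rows DD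
certificate of those rows ALONE (`PSD.Packed.checkRows` on `(twinRows …).map (packRow w)` +
`packable`, i.e. the list-data lane of `PackedGramRowsOfLists.lean`, one piece or in row ranges) and
the margin `n ≤ s`. What is shipped per block: the packed factor columns `Crows` (`≈ s²·v/8` bytes:
134 KB at `s = 189` equilibrated), the exponents `cs`, and six small constants — no twin rows, no
closeness files. [cite: Rump1999VerifiedLargeSystems, §4 Algorithm 4.1 step 7; HornJohnson2013, Obs. 7.1.8]

WHAT THIS FILE DOES NOT CERTIFY: existence of a DD factor for the implicit twin (the producer finds
`B` in floats and verifies exactly; the kernel re-verifies); anything beyond `QuadNonneg`; the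
identity side. Kernel cost is the list-data lane's (in-kernel `packRow` of every twin row) plus one
rounding per entry; the twin rows are a shared closed term, evaluated once per `decide`.
-/

namespace Literature.Computation.Certificates

namespace PSD

/-! ### Round half up, integer operations only, and its closeness -/

/-- `⌊c·q + ½⌋` computed with INTEGER operations only — `(2·c·num + den) / (2·den)` with the
Euclidean `/` of `ℤ` (divisor `2·den > 0`): one multiplication, one addition, one division per entry in
the kernel, no `ℚ` normalisation. [folklore] -/
def roundHUZ (c : ℕ) (q : ℚ) : ℤ := (2 * (c : ℤ) * q.num + q.den) / (2 * (q.den : ℤ))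

/-- `|c·q − ⌊c·q + ½⌋| ≤ ½` for the integer-only rounding (the rounding step of Rump's perturbation
argument, `‖Δ‖ ≤ ½ ulp`). [cite: Rump1999VerifiedLargeSystems, §4 Algorithm 4.1 step 7] -/
theorem abs_sub_roundHUZ_le (c : ℕ) (q : ℚ) : |(c : ℚ) * q - (roundHUZ c q : ℚ)| ≤ 1 / 2 := by
  set A : ℤ := 2 * (c : ℤ) * q.num + q.den with hA
  set B : ℤ := 2 * (q.den : ℤ) with hB
  have hden : (0 : ℤ) < q.den := by exact_mod_cast q.den_pos
  have hBpos : 0 < B := by rw [hB]; linarith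
  have hr : roundHUZ c q = A / B := rfl
  obtain ⟨hdiv, hm0, hm1⟩ :=
    (Int.ediv_emod_unique (a := A) (b := B) (r := A % B) (q := A / B) hBpos).mp ⟨rfl, rfl⟩
  have hBq : (0 : ℚ) < (B : ℚ) := by exact_mod_cast hBpos
  have ht : (c : ℚ) * q + 1 / 2 = (A : ℚ) / (B : ℚ) := by
    rw [eq_div_iff hBq.ne', hA, hB]
    push_cast
    have hq : q * (q.den : ℚ) = (q.num : ℚ) := Rat.mul_den_eq_num q
    linear_combination (2 * (c : ℚ)) * hq
  have hdivq : ((A % B : ℤ) : ℚ) + (B : ℚ) * ((A / B : ℤ) : ℚ) = (A : ℚ) := by exact_mod_cast hdiv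
  have hm0q : (0 : ℚ) ≤ ((A % B : ℤ) : ℚ) := by exact_mod_cast hm0
  have hm1q : ((A % B : ℤ) : ℚ) < (B : ℚ) := by exact_mod_cast hm1
  have e : (c : ℚ) * q - (roundHUZ c q : ℚ) = ((A % B : ℤ) : ℚ) / (B : ℚ) - 1 / 2 := by
    rw [hr]
    have : (c : ℚ) * q = (A : ℚ) / (B : ℚ) - 1 / 2 := by linarith
    rw [this, ← hdivq]
    field_simp
    ring
  rw [e, abs_le]
  constructor
  · have : 0 ≤ ((A % B : ℤ) : ℚ) / (B : ℚ) := div_nonneg hm0q hBq.le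
    linarith
  · have : ((A % B : ℤ) : ℚ) / (B : ℚ) < 1 := (div_lt_one hBq).mpr hm1q
    linarith

/-! ### The implicit twin rows -/

/-- One implicit twin row `i`, entries `j, j+1, …` (fuel-indexed, `headD`/`tail` walk so that missing
client entries read as `0` exactly as `matrixOfRows` does): entry
`4^b·(⌊S·2^{c_i+c_j}·q + ½⌋ − s·[i = j])` via `roundHUZ`, `c_j = csj.headD 0`. [cite: Rump1999VerifiedLargeSystems, §4 Algorithm 4.1 step 7] -/
def twinRow (S s b ci i : ℕ) : ℕ → ℕ → List ℕ → List ℚ → List ℤ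
  | 0, _, _, _ => []
  | fuel + 1, j, csj, qrow =>
      ((4 : ℤ) ^ b * (roundHUZ (S * 2 ^ (ci + csj.headD 0)) (qrow.headD 0) -
        if i = j then (s : ℤ) else 0)) :: twinRow S s b ci i fuel (j + 1) csj.tail qrow.tail

/-- The implicit twin rows `i, i+1, …` (fuel-indexed walk of the client rows with `headD []`/`tail`;
row `i` scaled by `c_i = csi.headD 0` against the full exponent list `cs`; every row has exactly `n`
entries). [cite: Rump1999VerifiedLargeSystems, §4 Algorithm 4.1 step 7] -/
def twinRows (S s b n : ℕ) (cs : List ℕ) : ℕ → ℕ → List ℕ → List (List ℚ) → List (List ℤ)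
  | 0, _, _, _ => []
  | fuel + 1, i, csi, Qrows =>
      twinRow S s b (csi.headD 0) i n 0 cs (Qrows.headD []) ::
        twinRows S s b n cs fuel (i + 1) csi.tail Qrows.tail

/-- **The implicit twin** of the block with rows `Qrows` (`n × n`), scale `S`, shift `s`, factor bits
`b`, equilibration exponents `cs`: `M = 4^b·(round(S·D Q D) − s·1)` as `n` integer rows of `n` entries,
computed in the kernel. [cite: Rump1999VerifiedLargeSystems, §4 Algorithm 4.1 step 7; HornJohnson2013, Obs. 7.1.8] -/
def twinOf (S s b n : ℕ) (cs : List ℕ) (Qrows : List (List ℚ)) : List (List ℤ) :=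
  twinRows S s b n cs n 0 cs Qrows

/-- Entry semantics of `twinRow`. [folklore] -/
private theorem getD_twinRow (S s b ci i : ℕ) :
    ∀ (fuel j₀ : ℕ) (csj : List ℕ) (qrow : List ℚ) (t : ℕ), t < fuel →
      (twinRow S s b ci i fuel j₀ csj qrow).getD t 0 =
        (4 : ℤ) ^ b * (roundHUZ (S * 2 ^ (ci + csj.getD t 0)) (qrow.getD t 0) -
          if i = j₀ + t then (s : ℤ) else 0)
  | 0, _, _, _, _, h => (Nat.not_lt_zero _ h).elim
  | fuel + 1, j₀, csj, qrow, 0, _ => by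
      cases csj <;> cases qrow <;> simp [twinRow]
  | fuel + 1, j₀, csj, qrow, t + 1, h => by
      have ih := getD_twinRow S s b ci i fuel (j₀ + 1) csj.tail qrow.tail t (by omega)
      have e1 : j₀ + 1 + t = j₀ + (t + 1) := by omega
      cases csj <;> cases qrow <;> simp_all [twinRow]

/-- Row semantics of `twinRows`. [folklore] -/
private theorem getD_twinRows (S s b n : ℕ) (cs : List ℕ) :
    ∀ (fuel i₀ : ℕ) (csi : List ℕ) (Qrows : List (List ℚ)) (r : ℕ), r < fuel →
      (twinRows S s b n cs fuel i₀ csi Qrows).getD r [] =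
        twinRow S s b (csi.getD r 0) (i₀ + r) n 0 cs (Qrows.getD r [])
  | 0, _, _, _, _, h => (Nat.not_lt_zero _ h).elim
  | fuel + 1, i₀, csi, Qrows, 0, _ => by
      cases csi <;> cases Qrows <;> simp [twinRows]
  | fuel + 1, i₀, csi, Qrows, r + 1, h => by
      have ih := getD_twinRows S s b n cs fuel (i₀ + 1) csi.tail Qrows.tail r (by omega)
      have e1 : i₀ + 1 + r = i₀ + (r + 1) := by omega
      cases csi <;> cases Qrows <;> simp_all [twinRows]

/-- **Entries of the implicit twin**: `M i j = 4^b·(⌊S·2^{c_i+c_j}·Q i j + ½⌋ − s·[i = j])`.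
[cite: Rump1999VerifiedLargeSystems, §4 Algorithm 4.1 step 7] -/
theorem matrixOfRows_twinOf (S s b n : ℕ) (cs : List ℕ) (Qrows : List (List ℚ)) (i j : Fin n) :
    matrixOfRows n n (twinOf S s b n cs Qrows) i j =
      (4 : ℤ) ^ b * (roundHUZ (S * 2 ^ (cs.getD i.val 0 + cs.getD j.val 0))
        (matrixOfRows n n Qrows i j) - if i = j then (s : ℤ) else 0) := by
  rw [matrixOfRows_apply, matrixOfRows_apply, twinOf, getD_twinRows _ _ _ _ _ _ _ _ _ _ i.isLt,
    getD_twinRow _ _ _ _ _ _ _ _ _ _ j.isLt]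
  simp [Fin.ext_iff]

/-- **Closeness of the implicit twin is a lemma, not a kernel pass**: with `S′ = S·4^b`, `s′ = s·4^b`,
`e′ = 4^b`, every entry satisfies `|S′·(D Q D) i j − (M i j + s′·[i = j])| ≤ e′` (indeed `≤ e′/2`).
[cite: Rump1999VerifiedLargeSystems, §4 Algorithm 4.1 step 7] -/
theorem twinOf_close (S s b n : ℕ) (cs : List ℕ) (Qrows : List (List ℚ)) (i j : Fin n) :
    |((S * 4 ^ b : ℕ) : ℚ) * matrixOfRows n n (scaleRows2 cs cs Qrows) i j -
        (((matrixOfRows n n (twinOf S s b n cs Qrows) i j : ℤ) : ℚ) +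
          if i = j then ((s * 4 ^ b : ℕ) : ℚ) else 0)| ≤ ((4 ^ b : ℕ) : ℚ) := by
  rw [matrixOfRows_twinOf, matrixOfRows_scaleRows2]
  set c : ℕ := S * 2 ^ (cs.getD i.val 0 + cs.getD j.val 0) with hc
  set q : ℚ := matrixOfRows n n Qrows i j with hq
  have hr := abs_sub_roundHUZ_le c q
  have h4 : (0 : ℚ) < (4 : ℚ) ^ b := by positivity
  have key : ((S * 4 ^ b : ℕ) : ℚ) * (q * 2 ^ (cs.getD i.val 0 + cs.getD j.val 0)) -
      ((((4 : ℤ) ^ b * (roundHUZ c q - if i = j then (s : ℤ) else 0) : ℤ) : ℚ) +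
        if i = j then ((s * 4 ^ b : ℕ) : ℚ) else 0) = (4 : ℚ) ^ b * ((c : ℚ) * q - (roundHUZ c q : ℚ)) := by
    rw [hc]
    split <;> push_cast <;> ring
  rw [key, abs_mul, abs_of_pos h4]
  push_cast
  nlinarith [abs_nonneg ((c : ℚ) * q - (roundHUZ c q : ℚ))]

/-! ### PSD from the implicit twin -/

section Implicit

variable {R : Type*} [Field R] [LinearOrder R] [IsStrictOrderedRing R]

/-- **PSD by the IMPLICIT twin, DD certificate in one piece**: the packed-rows DD check of the kernel-
computed twin rows (`checkRows` on `(twinOf …).map (packRow w)` + `packable`), `0 < S`, and the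
margin `n ≤ s` give `∀ y, 0 ≤ yᵀ Q y` for the ORIGINAL rows. Nothing about the twin is shipped but its
factor. [cite: Rump1999VerifiedLargeSystems, §4 Algorithm 4.1 step 7; HornJohnson2013, Obs. 7.1.8] -/
theorem quadForm_nonneg_of_implicitTwin {n w v x O S s b : ℕ} {Qrows : List (List ℚ)}
    {cs ds Crows : List ℕ}
    (hcheck : Packed.checkRows n w 1 v x O ((twinOf S s b n cs Qrows).map (Packed.packRow w)) ds Crows
      = true)
    (hpack : Packed.packable n w (twinOf S s b n cs Qrows) = true) (hS : 0 < S) (hmargin : n ≤ s)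
    (y : Fin n → R) :
    0 ≤ ∑ i, ∑ j, y i * ((matrixOfRows n n Qrows i j : ℚ) : R) * y j := by
  refine quadForm_nonneg_of_diagScaled _ (fun i => (2 : R) ^ cs.getD i.val 0)
    (fun i => pow_ne_zero _ two_ne_zero) (fun z => ?_) y
  have h := quadForm_nonneg_of_twinMatrix_of_close (R := R) (Qrows := scaleRows2 cs cs Qrows)
    (S := S * 4 ^ b) (s := s * 4 ^ b) (e := 4 ^ b)
    (Packed.isGramCertZ_matrixOfRows_of_checkRows hcheck hpack) (Nat.mul_pos hS (Nat.pow_pos (by omega)))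
    (fun i j => twinOf_close S s b n cs Qrows i j) (by nlinarith [Nat.pow_pos (n := b) (by omega : 0 < 4)]) z
  refine h.trans_eq (Finset.sum_congr rfl fun i _ => Finset.sum_congr rfl fun j _ => ?_)
  rw [matrixOfRows_scaleRows2]
  push_cast
  ring

/-- **PSD by the IMPLICIT twin, DD certificate SPLIT in row ranges** (`checkRowsHead` + `RangesOK`
on the packed kernel-computed rows + `packable`) — the shape for large blocks.
[cite: Rump1999VerifiedLargeSystems, §4 Algorithm 4.1 step 7; HornJohnson2013, Obs. 7.1.8] -/
theorem quadForm_nonneg_of_implicitTwin_split {n w v x O S s b : ℕ} {Qrows : List (List ℚ)}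
    {cs ds Crows cnts : List ℕ}
    (hhead : Packed.checkRowsHead n w 1 v x O ((twinOf S s b n cs Qrows).map (Packed.packRow w)) ds
      Crows = true)
    (hrows : Packed.RangesOK w v x O ((twinOf S s b n cs Qrows).map (Packed.packRow w)) ds Crows 0 cnts)
    (hcnts : n ≤ cnts.sum) (hpack : Packed.packable n w (twinOf S s b n cs Qrows) = true)
    (hS : 0 < S) (hmargin : n ≤ s) (y : Fin n → R) :
    0 ≤ ∑ i, ∑ j, y i * ((matrixOfRows n n Qrows i j : ℚ) : R) * y j := by
  refine quadForm_nonneg_of_diagScaled _ (fun i => (2 : R) ^ cs.getD i.val 0)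
    (fun i => pow_ne_zero _ two_ne_zero) (fun z => ?_) y
  have h := quadForm_nonneg_of_twinMatrix_of_close (R := R) (Qrows := scaleRows2 cs cs Qrows)
    (S := S * 4 ^ b) (s := s * 4 ^ b) (e := 4 ^ b)
    (Packed.isGramCertZ_matrixOfRows_of_checkRowsRanges hhead hrows hcnts hpack)
    (Nat.mul_pos hS (Nat.pow_pos (by omega)))
    (fun i j => twinOf_close S s b n cs Qrows i j) (by nlinarith [Nat.pow_pos (n := b) (by omega : 0 < 4)]) z
  refine h.trans_eq (Finset.sum_congr rfl fun i _ => Finset.sum_congr rfl fun j _ => ?_)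
  rw [matrixOfRows_scaleRows2]
  push_cast
  ring

end Implicit

end PSD

namespace SOS

namespace GramL

variable {R : Type*} [Field R] [LinearOrder R] [IsStrictOrderedRing R]

/-- **Twin lane, IMPLICIT twin** — the emitters' shape for a `GramL` block: ship the packed factor
columns `Crows` (+ exponents `cs`), decide `checkRows` on the kernel-computed twin rows and
`packable`, conclude `QuadNonneg`. [cite: Rump1999VerifiedLargeSystems, §4 Algorithm 4.1 step 7; HornJohnson2013, Obs. 7.1.8] -/
theorem quadNonneg_of_implicitTwin (g : GramL) {w v x O S s b : ℕ} {cs ds Crows : List ℕ}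
    (hcheck : PSD.Packed.checkRows g.s w 1 v x O
      ((PSD.twinOf S s b g.s cs g.Q).map (PSD.Packed.packRow w)) ds Crows = true)
    (hpack : PSD.Packed.packable g.s w (PSD.twinOf S s b g.s cs g.Q) = true) (hS : 0 < S)
    (hmargin : g.s ≤ s) : g.toGramSOS.QuadNonneg R :=
  g.quadNonneg_of_quadForm fun y => PSD.quadForm_nonneg_of_implicitTwin hcheck hpack hS hmargin y

/-- **Twin lane, IMPLICIT twin, DD certificate split in row ranges.**
[cite: Rump1999VerifiedLargeSystems, §4 Algorithm 4.1 step 7; HornJohnson2013, Obs. 7.1.8] -/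
theorem quadNonneg_of_implicitTwin_split (g : GramL) {w v x O S s b : ℕ}
    {cs ds Crows cnts : List ℕ}
    (hhead : PSD.Packed.checkRowsHead g.s w 1 v x O
      ((PSD.twinOf S s b g.s cs g.Q).map (PSD.Packed.packRow w)) ds Crows = true)
    (hrows : PSD.Packed.RangesOK w v x O ((PSD.twinOf S s b g.s cs g.Q).map (PSD.Packed.packRow w))
      ds Crows 0 cnts)
    (hcnts : g.s ≤ cnts.sum) (hpack : PSD.Packed.packable g.s w (PSD.twinOf S s b g.s cs g.Q) = true)
    (hS : 0 < S) (hmargin : g.s ≤ s) : g.toGramSOS.QuadNonneg R :=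
  g.quadNonneg_of_quadForm fun y =>
    PSD.quadForm_nonneg_of_implicitTwin_split hhead hrows hcnts hpack hS hmargin y

/-- Test (implicit twin, one piece): the `2 × 2` block of `PsdRoundedTwinPacked.lean` with `S = 4`,
`s = 2`, `b = 0`, no scaling — the kernel recomputes the twin rows `[[6, −4], [−4, 6]]` itself; only
the factor columns are given. -/
example : (GramL.toGramSOS ⟨[[1, 0], [0, 1]],
      [[(2 : ℚ) + 1 / 3 ^ 40, -1], [-1, (2 : ℚ) - 1 / 3 ^ 40]], [], []⟩).QuadNonneg ℝ :=
  GramL.quadNonneg_of_implicitTwin _ (w := 4) (v := 3) (x := 8) (O := 3) (S := 4) (s := 2) (b := 0)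
    (cs := [0, 0]) (ds := [1, 1]) (Crows := [[2, 0], [-2, 1]].map (PSD.Packed.packCol 3 3))
    (by decide +kernel) (by decide +kernel) (by decide) (by decide)

/-- Test (implicit twin, equilibrated, split): `Q = D⁻¹ Q₀ D⁻¹`, `D = diag(2, 1)`, `cs = [1, 0]`, DD
row ranges `[1, 1]`. -/
example : (GramL.toGramSOS ⟨[[1, 0], [0, 1]],
      [[((2 : ℚ) + 1 / 3 ^ 40) / 4, -1 / 2], [-1 / 2, (2 : ℚ) - 1 / 3 ^ 40]], [], []⟩).QuadNonneg ℝ :=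
  GramL.quadNonneg_of_implicitTwin_split _ (w := 4) (v := 3) (x := 8) (O := 3) (S := 4) (s := 2)
    (b := 0) (cs := [1, 0]) (ds := [1, 1]) (Crows := [[2, 0], [-2, 1]].map (PSD.Packed.packCol 3 3))
    (cnts := [1, 1]) (by decide +kernel) ⟨by decide +kernel, by decide +kernel, trivial⟩ (by decide)
    (by decide +kernel) (by decide) (by decide)

end GramL

end SOS

end Literature.Computation.Certificates
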